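import Summits.HubbardSuperconductivity.HubbardSuperconductivity.Theorems.ThermalWedgeTwPureThermalBoundGseeMaster
import Summits.HubbardSuperconductivity.HubbardSuperconductivity.Theorems.ChiralWindowCwSsbToEvenTorusLROCanonicalEnergyDensity
import HarnessLib

/-!
# Crux `CwSsbToEvenTorusLRO` (stmt-HubbardSuperconductivity-10439, route `ChiralWindow`), line
`griffiths-block-slope` — stub `stub_canonicalSupportingPotential`: `T = 0` equivalence of
ensembles for the Hubbard torus (= item stmt-HubbardSuperconductivity-9491
`CanonicalSupportingPotential`, which the same theorem closes by `Iff.rfl`)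

From the thermodynamic limit `E_{L×L}(2⌊nL²/2⌋)/L² → e(n) := energyDensity2D 1 U n` at every
density `n ∈ [0, 2)` and the convexity of `e` on `[0, 2)` — for EVERY real `U` the support theorem
`csp_energyDensity` (`ChiralWindowCwSsbToEvenTorusLROCanonicalEnergyDensity.lean`; the Literature
versions assume `U ≥ 0`) — we prove for every real `U` and `δ ∈ (0, 1)`, with
`N_L = 2⌊(1−δ)L²/2⌋` and `μ` ANY subgradient of `e` at `1 − δ`:

  `|minEnergyOn (szSector N_L 0) (hubbardTorus 2 L 1 U) − μ N_L − groundEnergy (hubbardTorusWith 2 L 1 U μ)| ≤ εL²`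

for all `L ≥ L₀(ε)` — the statement of `CanonicalSupportingPotential` (Ruelle 1969 §3.4,
equivalence of the canonical and grand-canonical descriptions at `T = 0` via convexity):

* `csp_energyDensity2D_le` — the tiling lower bound `e(2m/L²) ≤ E_{L×L}(2m)/L² + 16|t|/L`;
* `csp_master_ub` / `csp_master_lb` — eventually `E_L(N_L) ≤ L² e(1−δ) + ηL²` and, for ALL
  `N ≤ 2L²`, `L² e(1−δ) + μ(N − (1−δ)L²) − ηL² ≤ E_L(N)` (odd and extreme `N` by one or two
  one-particle steps, `torusCost_succ/pred`);
* `csp_supportingPotential_of_energyDensity` — limit + convexity imply the statement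
  (`E₀(H − μN) = min_N (E(N) − μN)`, `gc_eq_iInf`; the `S^z = 0` restriction is immaterial by
  `SU(2)`, `groundEnergyAt_eq_minEnergyOn_szSector`); `stub_canonicalSupportingPotential` — the
  registered stub, fed with `csp_energyDensity`.

No definition is introduced. [folklore]
-/

noncomputable section

set_option linter.dupNamespace false

namespace Summit.HubbardSuperconductivity.HubbardSuperconductivity.Theorems.CwSsbToEvenTorusLRO

open Literature.MathematicalPhysics.QuantumLattice Matrix Finset Filter Topology
open Literature.MathematicalPhysics.QuantumLattice.ThermodynamicLimit
open Summit.HubbardSuperconductivity.HubbardSuperconductivity.Theorems.TwPureThermalBoundGsee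

/-- **The limit is an infimum (tiling lower bound at every finite size)**, given the limit at every
density: for `L ≥ 1` and an even particle number `2m < 2L²`,
`e(2m/L²) ≤ E_{L×L}(2m)/L² + 16|t|/L` (tile the `KL × KL` torus by `K²` copies of the `L × L`
torus, each carrying `2m` particles, and let `K → ∞`). [folklore] -/
theorem csp_energyDensity2D_le {t U : ℝ}
    (hlim : ∀ n : ℝ, 0 ≤ n → n < 2 → Tendsto (fun L : ℕ =>
      groundEnergyAt (fermionRectTorusGraph L L) t U (rectN n L) / (L : ℝ) ^ 2) atTop
        (𝓝 (energyDensity2D t U n)))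
    {L : ℕ} (hL : 1 ≤ L) {m : ℕ} (hm : m < L * L) :
    energyDensity2D t U ((2 * m : ℕ) / (L : ℝ) ^ 2) ≤
      groundEnergyAt (fermionRectTorusGraph L L) t U (2 * m) / (L : ℝ) ^ 2 + 16 * |t| / L := by
  -- adapted from `ThermodynamicLimit.energyDensity2D_le` (HubbardTorus2DEnergyDensity.lean)
  set n : ℝ := (2 * m : ℕ) / (L : ℝ) ^ 2 with hn
  have hLpos : (0 : ℝ) < L := by exact_mod_cast hL
  have hn0 : 0 ≤ n := by positivity
  have hn2 : n < 2 := by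
    rw [hn, div_lt_iff₀ (by positivity)]
    have : ((2 * m : ℕ) : ℝ) < 2 * (L * L : ℕ) := by exact_mod_cast (by omega : 2 * m < 2 * (L * L))
    push_cast at this ⊢; nlinarith
  have hsub : Tendsto (fun k : ℕ => (k + 1) * L) atTop atTop :=
    tendsto_atTop_mono (fun k => (Nat.le_succ k).trans (Nat.le_mul_of_pos_right _ hL)) tendsto_id
  refine le_of_tendsto' ((hlim n hn0 hn2).comp hsub) fun k => ?_
  simp only [Function.comp_apply]
  rw [rectN_div_mul hL (k + 1) m]
  have htile := groundEnergyAt_square_tiling L t U k (fun _ _ => 2 * m) (fun _ _ => by omega)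
  simp only [Finset.sum_const, Finset.card_univ, Fintype.card_fin, smul_eq_mul, nsmul_eq_mul]
    at htile
  have hE : groundEnergyAt (fermionRectTorusGraph ((k + 1) * L) ((k + 1) * L)) t U
      ((k + 1) * (k + 1) * (2 * m)) ≤ ((k + 1 : ℕ) : ℝ) * ((k + 1 : ℕ) *
        groundEnergyAt (fermionRectTorusGraph L L) t U (2 * m)) + 16 * |t| * L * k * (k + 1) := by
    rw [show (k + 1) * (k + 1) * (2 * m) = (k + 1) * ((k + 1) * (2 * m)) by ring]
    exact htile
  push_cast at hE ⊢
  have ht0 : 0 ≤ |t| := abs_nonneg t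
  have hk1 : (k : ℝ) ≤ k + 1 := by linarith
  have h16 : 16 * |t| * (L : ℝ) * k * (k + 1) ≤ 16 * |t| * L * (k + 1) * (k + 1) := by gcongr
  set EK := groundEnergyAt (fermionRectTorusGraph ((k + 1) * L) ((k + 1) * L)) t U
    ((k + 1) * (k + 1) * (2 * m)) with hEK
  set EL := groundEnergyAt (fermionRectTorusGraph L L) t U (2 * m) with hEL
  have h1 : EK ≤ ((k : ℝ) + 1) ^ 2 * (EL + 16 * |t| * L) := by nlinarith [hE, h16]
  calc EK / (((k : ℝ) + 1) * L) ^ 2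
      ≤ ((k : ℝ) + 1) ^ 2 * (EL + 16 * |t| * L) / (((k : ℝ) + 1) * L) ^ 2 :=
        div_le_div_of_nonneg_right h1 (by positivity)
    _ = EL / (L : ℝ) ^ 2 + 16 * |t| / L := by
        field_simp

/-- **Master upper bound** (pointwise convergence at the density `n₀`): eventually
`E_{torus L}(N_L(n₀)) ≤ L² e(n₀) + ηL²`. [folklore] -/
theorem csp_master_ub {U : ℝ}
    (hlim : ∀ n : ℝ, 0 ≤ n → n < 2 → Tendsto (fun L : ℕ =>
      groundEnergyAt (fermionRectTorusGraph L L) 1 U (rectN n L) / (L : ℝ) ^ 2) atTop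
        (𝓝 (energyDensity2D 1 U n)))
    {n₀ : ℝ} (hn0 : 0 ≤ n₀) (hn2 : n₀ < 2) {η : ℝ} (hη : 0 < η) :
    ∃ L₀ : ℕ, ∀ L : ℕ, L₀ ≤ L →
      groundEnergyAt (fermionTorusGraph 2 L) 1 U (rectN n₀ L) ≤
        (L : ℝ) ^ 2 * energyDensity2D 1 U n₀ + η * (L : ℝ) ^ 2 := by
  -- adapted from `TwPureThermalBoundGsee.master_ub`
  obtain ⟨L₀, hL₀⟩ := (Metric.tendsto_atTop.1 (hlim n₀ hn0 hn2)) η hη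
  refine ⟨max L₀ 1, fun L hL => ?_⟩
  have h3 := hL₀ L (le_of_max_le_left hL)
  have hL1 : (1 : ℝ) ≤ L := by exact_mod_cast le_of_max_le_right hL
  have hL2 : (0 : ℝ) < (L : ℝ) ^ 2 := by positivity
  rw [Real.dist_eq, abs_sub_lt_iff] at h3
  have h4 := h3.1
  rw [sub_lt_iff_lt_add, div_lt_iff₀ hL2, ← groundEnergyAt_fermionTorusGraph_two] at h4
  linarith

/-- **Master lower bound.** If `s` is a subgradient at `n₀` of the energy density
`e = energyDensity2D 1 U` on `[0, 2)` (and the limit holds at every density), then for every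
`η > 0`, eventually in `L`, ALL sector energies of the `L × L` Hubbard torus lie above the
supporting line up to `ηL²`: `L² e(n₀) + s(N − n₀L²) − ηL² ≤ E_{torus L}(N)` for every `N ≤ 2L²`
(tiling lower bound at even `N < 2L²`; odd and extreme `N` by one or two one-particle steps).
[folklore] -/
theorem csp_master_lb {U : ℝ}
    (hlim : ∀ n : ℝ, 0 ≤ n → n < 2 → Tendsto (fun L : ℕ =>
      groundEnergyAt (fermionRectTorusGraph L L) 1 U (rectN n L) / (L : ℝ) ^ 2) atTop
        (𝓝 (energyDensity2D 1 U n)))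
    {n₀ : ℝ} {s : ℝ}
    (hs : ∀ y ∈ Set.Ico (0 : ℝ) 2, energyDensity2D 1 U n₀ + s * (y - n₀) ≤ energyDensity2D 1 U y)
    {η : ℝ} (hη : 0 < η) :
    ∃ L₀ : ℕ, ∀ L : ℕ, L₀ ≤ L → ∀ N : ℕ, N ≤ 2 * (L * L) →
      (L : ℝ) ^ 2 * energyDensity2D 1 U n₀ + s * (N - n₀ * (L : ℝ) ^ 2) - η * (L : ℝ) ^ 2 ≤
        groundEnergyAt (fermionTorusGraph 2 L) 1 U N := by
  -- adapted from `TwPureThermalBoundGsee.master_lb`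
  set K : ℝ := 18 * (2 + |U|) with hK
  have hK0 : 0 ≤ K := by positivity
  set C : ℝ := 16 + 4 * K + 4 * |s| with hC
  obtain ⟨L₁, hL₁⟩ := exists_nat_gt (C / η)
  refine ⟨max L₁ 2, fun L hL N hN => ?_⟩
  have hL2 : 2 ≤ L := le_of_max_le_right hL
  haveI : NeZero L := ⟨by omega⟩
  have hLr : (2 : ℝ) ≤ L := by exact_mod_cast hL2
  have hslack : 16 * (L : ℝ) + 4 * K + 4 * |s| ≤ η * (L : ℝ) ^ 2 := by
    have h1 : C / η < L := hL₁.trans_le (by exact_mod_cast le_of_max_le_left hL)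
    rw [div_lt_iff₀ hη] at h1
    have : 16 * (L : ℝ) + 4 * K + 4 * |s| ≤ C * L := by
      have h4 : (4 * K + 4 * |s|) * 1 ≤ (4 * K + 4 * |s|) * L :=
        mul_le_mul_of_nonneg_left (by linarith) (by positivity)
      simp only [hC]; linarith
    nlinarith
  have hs0 : 0 ≤ |s| := abs_nonneg s
  set e := energyDensity2D 1 U with he
  set E : ℕ → ℝ := fun N => groundEnergyAt (fermionTorusGraph 2 L) 1 U N with hE
  -- the core bound at even particle numbers `2m < 2L²`
  have core : ∀ m : ℕ, m < L * L →
      (L : ℝ) ^ 2 * e n₀ + s * ((2 * m : ℕ) - n₀ * (L : ℝ) ^ 2) - 16 * L ≤ E (2 * m) := by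
    intro m hm
    have h1 := csp_energyDensity2D_le hlim (by omega : 1 ≤ L) hm
    rw [← groundEnergyAt_fermionTorusGraph_two, abs_one, mul_one] at h1
    have hL2' : (0 : ℝ) < (L : ℝ) ^ 2 := by positivity
    have hy : ((2 * m : ℕ) : ℝ) / (L : ℝ) ^ 2 ∈ Set.Ico (0 : ℝ) 2 := by
      refine ⟨by positivity, ?_⟩
      rw [div_lt_iff₀ hL2']
      have : ((2 * m : ℕ) : ℝ) < 2 * (L * L : ℕ) := by exact_mod_cast (by omega : 2 * m < 2 * (L * L))
      push_cast at this ⊢; nlinarith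
    have h3 := mul_le_mul_of_nonneg_left h1 hL2'.le
    rw [mul_add, mul_div_cancel₀ _ hL2'.ne'] at h3
    have h5 := mul_le_mul_of_nonneg_left (hs _ hy) hL2'.le
    have h4 : (L : ℝ) ^ 2 * (e n₀ + s * (((2 * m : ℕ) : ℝ) / (L : ℝ) ^ 2 - n₀)) =
        (L : ℝ) ^ 2 * e n₀ + s * ((2 * m : ℕ) - n₀ * (L : ℝ) ^ 2) := by
      field_simp
    have h6 : (L : ℝ) ^ 2 * (16 / (L : ℝ)) = 16 * L := by
      field_simp
    rw [h4] at h5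
    rw [h6] at h3
    show _ ≤ groundEnergyAt (fermionTorusGraph 2 L) 1 U (2 * m)
    linarith
  -- one-particle steps
  have hLL : (((L * L : ℕ) : ℝ)) = (L : ℝ) ^ 2 := by push_cast; ring
  have stepUp : ∀ M : ℕ, M < L * L → E (M + 1) - 2 * K ≤ E M := by
    intro M hM
    have h := torusCost_succ L U (N := M) (by omega)
    have hMr : (M : ℝ) < (L : ℝ) ^ 2 := by rw [← hLL]; exact_mod_cast hM
    have hfrac : 18 * (2 + |U|) * (2 * ((L * L : ℕ) : ℝ)) / (2 * ((L * L : ℕ) : ℝ) - M) ≤ 2 * K := by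
      rw [div_le_iff₀ (by rw [hLL]; nlinarith), hK, hLL]
      nlinarith
    simp only [hE]; linarith
  have stepDown : ∀ M : ℕ, L * L ≤ M → M ≤ 2 * (L * L) → E (M - 1) - 2 * K ≤ E M := by
    intro M hM hM2
    have h := torusCost_pred L U (N := M) (by nlinarith) hM2
    have hMr : (L : ℝ) ^ 2 ≤ M := by rw [← hLL]; exact_mod_cast hM
    have hMpos : (0 : ℝ) < M := by nlinarith
    have hfrac : 18 * (2 + |U|) * (2 * ((L * L : ℕ) : ℝ)) / M ≤ 2 * K := by
      rw [div_le_iff₀ hMpos, hK, hLL]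
      nlinarith
    simp only [hE]; linarith
  -- from an even neighbour `M = 2m`, `|M - N| ≤ 2`, `E N ≥ E M - 4K`
  have target : ∀ m : ℕ, m < L * L → (((2 * m : ℕ) : ℝ) - N ≤ 2 ∧ (N : ℝ) - (2 * m : ℕ) ≤ 2) →
      E (2 * m) - 4 * K ≤ E N →
      (L : ℝ) ^ 2 * e n₀ + s * (N - n₀ * (L : ℝ) ^ 2) - η * (L : ℝ) ^ 2 ≤ E N := by
    rintro m hm ⟨hd1, hd2⟩ hEN
    have hc := core m hm
    have h2 : s * ((N : ℝ) - (2 * m : ℕ)) ≤ |s| * 2 := by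
      calc s * ((N : ℝ) - (2 * m : ℕ)) ≤ |s * ((N : ℝ) - (2 * m : ℕ))| := le_abs_self _
        _ = |s| * |(N : ℝ) - (2 * m : ℕ)| := abs_mul _ _
        _ ≤ |s| * 2 := mul_le_mul_of_nonneg_left (abs_le.2 ⟨by linarith, by linarith⟩) hs0
    have h3 : s * ((N : ℝ) - n₀ * (L : ℝ) ^ 2) =
        s * (((2 * m : ℕ) : ℝ) - n₀ * (L : ℝ) ^ 2) + s * ((N : ℝ) - (2 * m : ℕ)) := by ring
    rw [h3]
    linarith
  have hLL1 : 1 < L * L := by nlinarith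
  rcases Nat.even_or_odd N with ⟨m, hm⟩ | ⟨m, hm⟩
  · -- `N = m + m` even
    rcases lt_or_ge m (L * L) with hm2 | hm2
    · exact target m hm2 ⟨by rw [hm]; push_cast; linarith, by rw [hm]; push_cast; linarith⟩
        (by rw [show N = 2 * m by omega]; linarith)
    · -- `N = 2L²`: two steps down to `2L² - 2`
      have hN2 : N = 2 * (L * L) := by omega
      refine target (L * L - 1) (by omega)
        ⟨by rw [hN2]; push_cast [Nat.cast_sub hLL1.le]; nlinarith, by
          rw [hN2]; push_cast [Nat.cast_sub hLL1.le]; nlinarith⟩ ?_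
      have h1 := stepDown (2 * (L * L)) (by omega) le_rfl
      have h2 := stepDown (2 * (L * L) - 1) (by omega) (by omega)
      rw [show 2 * (L * L) - 1 - 1 = 2 * (L * L - 1) by omega] at h2
      rw [hN2]
      linarith
  · -- `N = 2m + 1` odd
    rcases lt_or_ge N (L * L) with hN1 | hN1
    · -- step up
      refine target (m + 1) (by omega) ⟨by push_cast; rw [hm]; push_cast; linarith, by
        push_cast; rw [hm]; push_cast; linarith⟩ ?_
      have h1 := stepUp N hN1
      rw [show N + 1 = 2 * (m + 1) by omega] at h1
      linarith
    · -- step down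
      refine target m (by omega) ⟨by rw [hm]; push_cast; linarith, by rw [hm]; push_cast; linarith⟩ ?_
      have h1 := stepDown N hN1 hN
      rw [show N - 1 = 2 * m by omega] at h1
      linarith

/-- **Main theorem — `T = 0` equivalence of ensembles for the Hubbard torus from the canonical
energy density.** IF for the hopping `1` and every real `U` the canonical ground-state energy per
site `E_{L×L}(2⌊nL²/2⌋)/L²` of the Hubbard torus converges to `energyDensity2D 1 U n` at every
density `n ∈ [0, 2)` and `energyDensity2D 1 U` is convex on `[0, 2)` (the support file's
`csp_energyDensity`; the Literature has both for `U ≥ 0`), THEN `CanonicalSupportingPotential`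
(item stmt-HubbardSuperconductivity-9491) holds: for every real `U` and `δ ∈ (0, 1)` there is `μ`
— any subgradient of the energy density at `1 − δ` — with
`|minEnergyOn (szSector N_L 0) (hubbardTorus 2 L 1 U) − μ N_L − groundEnergy (hubbardTorusWith 2 L 1 U μ)| ≤ εL²`
for all even `L ≥ L₀(ε)`, `N_L = 2⌊(1 − δ)L²/2⌋` (master bounds `csp_master_ub/lb`,
`E₀(H − μN) = min_N (E(N) − μN)`, and `SU(2)` for the `S^z = 0` restriction). Ruelle (1969) §3.4.
[folklore] -/
theorem csp_supportingPotential_of_energyDensity :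
    (∀ t U : ℝ,
      (∀ n : ℝ, 0 ≤ n → n < 2 → Filter.Tendsto (fun L : ℕ =>
        groundEnergyAt (fermionRectTorusGraph L L) t U (ThermodynamicLimit.rectN n L) / (L : ℝ) ^ 2)
          Filter.atTop (nhds (ThermodynamicLimit.energyDensity2D t U n))) ∧
      ConvexOn ℝ (Set.Ico (0 : ℝ) 2) (ThermodynamicLimit.energyDensity2D t U)) →
    ∀ (U δ : ℝ), δ ∈ Set.Ioo (0:ℝ) 1 → ∃ μ : ℝ, ∀ ε : ℝ, 0 < ε → ∃ L₀ : ℕ, ∀ L : ℕ, Even L → L₀ ≤ L → |(hubbardTorus 2 L 1 U).minEnergyOn (szSector (2 * ⌊(1 - δ) * (L : ℝ) ^ 2 / 2⌋₊) 0) - μ * ((2 * ⌊(1 - δ) * (L : ℝ) ^ 2 / 2⌋₊ : ℕ) : ℝ) - Matrix.groundEnergy (hubbardTorusWith 2 L 1 U μ)| ≤ ε * (L : ℝ) ^ 2 := by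
  intro hdens U δ hδ
  obtain ⟨hlim, hconv⟩ := hdens 1 U
  obtain ⟨hδ0, hδ1⟩ := hδ
  set n₀ : ℝ := 1 - δ with hn₀
  have hn0 : 0 < n₀ := by simp only [hn₀]; linarith
  have hn2 : n₀ < 2 := by simp only [hn₀]; linarith
  -- `μ`: a subgradient at `n₀` of the convex energy density
  obtain ⟨s, hs⟩ := exists_subgradient_of_convexOn_Ico hconv ⟨hn0, hn2⟩
  refine ⟨s, fun ε hε => ?_⟩
  have hη : 0 < ε / 4 := by positivity
  obtain ⟨L₁, hL₁⟩ := csp_master_lb hlim hs hη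
  obtain ⟨L₂, hL₂⟩ := csp_master_ub hlim hn0.le hn2 hη
  obtain ⟨L₃, hL₃⟩ := exists_nat_gt (4 * |s| / ε)
  refine ⟨max (max L₁ L₂) (max L₃ 1), fun L _ hL => ?_⟩
  have hLL₁ : L₁ ≤ L := (le_max_left _ _).trans ((le_max_left _ _).trans hL)
  have hLL₂ : L₂ ≤ L := (le_max_right _ _).trans ((le_max_left _ _).trans hL)
  have hLL₃ : L₃ ≤ L := (le_max_left _ _).trans ((le_max_right _ _).trans hL)
  have hL1 : 1 ≤ L := (le_max_right _ _).trans ((le_max_right _ _).trans hL)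
  have hL1r : (1 : ℝ) ≤ L := by exact_mod_cast hL1
  -- the `(N_L, S^z = 0)` sector energy is the `N_L`-sector energy (`SU(2)`)
  have hNL : 2 * ⌊(1 - δ) * (L : ℝ) ^ 2 / 2⌋₊ = rectN n₀ L := rfl
  have hNle : rectN n₀ L ≤ 2 * (L * L) := rectN_le_two_mul hn0.le hn2.le L
  have hhalf : ⌊(1 - δ) * (L : ℝ) ^ 2 / 2⌋₊ ≤ Fintype.card (FermionTorus 2 L) := by
    rw [card_fermionTorus_two']
    rw [← hNL] at hNle; omega
  have hSU2 := groundEnergyAt_eq_minEnergyOn_szSector (fermionTorusGraph 2 L) 1 U hhalf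
  rw [show hubbardTorus 2 L 1 U = hamiltonian (fermionTorusGraph 2 L) 1 U from rfl, ← hSU2, hNL]
  -- the grand-canonical ground energy is attained in a sector `N°` and lies below every sector
  obtain ⟨N₀, hN₀, hgc⟩ := exists_gcSector L U s
  have hlow := gc_le_sector L U s hNle
  -- master bounds
  have h1 := hL₁ L hLL₁ N₀ hN₀
  have h2 := hL₂ L hLL₂
  have h3 := rectN_le hn0.le L
  have h4 := lt_rectN_add_two n₀ L
  have hslack : 2 * |s| ≤ ε / 2 * (L : ℝ) ^ 2 := by
    have : 4 * |s| / ε < L := hL₃.trans_le (by exact_mod_cast hLL₃)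
    rw [div_lt_iff₀ hε] at this
    nlinarith [abs_nonneg s]
  have h5 : s * (n₀ * (L : ℝ) ^ 2 - rectN n₀ L) ≤ 2 * |s| := by
    calc s * (n₀ * (L : ℝ) ^ 2 - rectN n₀ L) ≤ |s * (n₀ * (L : ℝ) ^ 2 - rectN n₀ L)| := le_abs_self _
      _ = |s| * |n₀ * (L : ℝ) ^ 2 - rectN n₀ L| := abs_mul _ _
      _ ≤ |s| * 2 := mul_le_mul_of_nonneg_left (abs_le.2 ⟨by linarith, by linarith⟩) (abs_nonneg s)
      _ = 2 * |s| := by ring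
  rw [abs_le]
  constructor
  · nlinarith [hlow, hε]
  · rw [hgc]
    nlinarith [h1, h2, h5, hslack]


/-- **Stub `stub_canonicalSupportingPotential`** of the line `griffiths-block-slope` (crux
`CwSsbToEvenTorusLRO`) — verbatim the route item stmt-HubbardSuperconductivity-9491
`CanonicalSupportingPotential` (**`T = 0` equivalence of ensembles for the Hubbard torus**): for
every real `U` and `δ ∈ (0, 1)` there is `μ` (any subgradient at `1 − δ` of the convex limiting
canonical energy density `energyDensity2D 1 U`) with
`|minEnergyOn (szSector N_L 0) (hubbardTorus 2 L 1 U) − μ·N_L − groundEnergy (hubbardTorusWith 2 L 1 U μ)| ≤ εL²`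
for all even `L ≥ L₀(ε)`, `N_L = 2⌊(1 − δ)L²/2⌋` — existence and convexity of the energy density for
every real `U` (`csp_energyDensity`) fed into `csp_supportingPotential_of_energyDensity`.
Ruelle, *Statistical Mechanics* (1969) §3.4. [folklore] -/
theorem stub_canonicalSupportingPotential :
    ∀ (U δ : ℝ), δ ∈ Set.Ioo (0:ℝ) 1 → ∃ μ : ℝ, ∀ ε : ℝ, 0 < ε → ∃ L₀ : ℕ, ∀ L : ℕ, Even L → L₀ ≤ L → |(hubbardTorus 2 L 1 U).minEnergyOn (szSector (2 * ⌊(1 - δ) * (L : ℝ) ^ 2 / 2⌋₊) 0) - μ * ((2 * ⌊(1 - δ) * (L : ℝ) ^ 2 / 2⌋₊ : ℕ) : ℝ) - Matrix.groundEnergy (hubbardTorusWith 2 L 1 U μ)| ≤ ε * (L : ℝ) ^ 2 := by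
  exact csp_supportingPotential_of_energyDensity csp_energyDensity

end Summit.HubbardSuperconductivity.HubbardSuperconductivity.Theorems.CwSsbToEvenTorusLRO

end
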